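import Literature.MathematicalPhysics.QuantumFieldTheory.Balaban1983to89.T4HistoryLipschitzRecursion
import Summits.QuantumFields.BalabanUV.T4Continuum.Spine.NE9.SchurMemory

/-!
# T⁴ programme, spine estimate NE9 (node U3, history side) — THE RATE-FREE RENEWAL: a SCHUR-CONTRACTIVE old-term channel
# gives NE9 with SCHUR-BOUNDED history moduli (no geometric rate anywhere), and the record's smallness clause N2
# `ω + c < 1` IS the Schur contractivity of Bałaban's geometric channel — census item of cell `pub-balaban-gaps`, seat ne9 (gen 3)

Cell `pub-balaban-gaps` (YM blitz G2, seat ne9, unit `pub-balaban-gaps-ne9-g3`; record `run/shared/lean/pub/pub-balaban-gaps/ne/NE9.md`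
§5 row C22).  Summits-side bookkeeping over the Literature SHAPES of the NE9 recursion file `T4HistoryLipschitzRecursion`
(`ScaleZeroFree`, `StepLipschitz`, `RenewalSuper`, `ne9_of_stepLipschitz` BY NAME) and the seat's gen-3 currency file `Spine/NE9/SchurMemory`
(`colSum_le_of_fadingMemory`, `rowSum_le_of_fadingMemory`, `ne9_bracket_of_colSum` BY NAME); nothing of the row's `Support/NE9*` modules is
imported or edited.  Two small DEFINITIONS are made (`minTable`, `minMod`: the minimal solution of the renewal equalities, built row by row)
— they are the objects the theorems are about, not hypothesis shapes.

WHY.  The record's mechanism for NE9 (`T4HistoryLipschitzRecursion.ne9_and_fadingMemory_of_geometricStep`) runs ONE per-step inequality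
`StepLipschitz E W κ lam a` — the term created at step `k+1` is Lipschitz in the last coupling (constant `lam k`) and in the old terms created at
step `j ≤ k` (constants `a k j`) — through the renewal inequalities `RenewalSuper`, and SOLVES them under the GEOMETRIC channel bound
`a k j ≤ c·ω^{k−j}` by the product moduli `ℓ(ω+c)^{k−1−i}`; the memory fades iff `ω + c < 1` (clause N2, `sticky_not_fadingMemory`).  The
gen-3 currency file showed that what nodes U5b and U3 → U6 actually consume are the two SCHUR norms of the moduli (row sums, column sums).
This file removes the geometric rate from the MECHANISM as well:
* the MINIMAL solution `minMod lam a` of the renewal equalities (`Λ (k+1) k = lam k`, `Λ (k+1) i = Σ_{j ∈ (i, k]} a k j·Λ j i` for `i < k`,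
  `Λ k i = 0` for `k ≤ i`; §1) is a `RenewalSuper` family, hence a family of NE9 moduli for every functional obeying `ScaleZeroFree` +
  `StepLipschitz` (`ne9_minMod`), nonnegative when `lam, a ≥ 0`;
* COLUMN SCHUR BOUND (§2): if the channel's COLUMN sums are `≤ α < 1` — `Σ_{k ≥ j} a k j ≤ α`: the total weight with which ONE created
  term re-enters ALL later terms is `< 1` — and `lam ≤ ℓ`, then every column of `minMod` is `≤ ℓ∕(1−α)` (`colSum_minMod_le`; the renewal
  step `S_{N+1} ≤ ℓ + α·S_N` is `colSum_minMod_succ_le`);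
* ROW SCHUR BOUND (§2): if the channel's ROW sums are `≤ α′ < 1` — `Σ_{j ≤ k} a k j ≤ α′`: the new term's total sensitivity to ALL old
  terms is `< 1` — then every row of `minMod` is `≤ ℓ∕(1−α′)` (`rowSum_minMod_le`, strong induction on the row);
* END TO END (§3): `ScaleZeroFree` + `StepLipschitz` + column-Schur channel ⇒ NE9 with column-bounded moduli ⇒ (gen-3 currency file) an ℓ¹
  coupling bracket against ℓ¹ coupling discrepancies, `Σ_j b_j ≤ ℓ(1−α)⁻¹·Σ_i d_i`, i.e. node U6's input — NO `FadingMemory`, no rate `θ`,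
  no `InjectedRate` (`ne9_colBounded_of_schurStep`, `ne9_l1Bracket_of_schurStep`); the row version serves node U5b and the β-side row split
  (`ne9_rowBounded_of_schurStep`);
* CONSISTENCY WITH THE RECORD (§4): Bałaban's channel is geometric, `0 ≤ a k j ≤ c·ω^{k−j}` — which IS `T4OutputRate.FadingMemory c ω a` read
  on the channel — so both its Schur norms are `≤ c(1−ω)⁻¹` (`schurNorms_of_geometricChannel`), and `c(1−ω)⁻¹ < 1 ⟺ ω + c < 1`
  (`schur_lt_one_iff`): the record's clause N2 is EXACTLY the Schur contractivity of the geometric channel, and the Schur form is its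
  intrinsic, rate-free statement (`ne9_colBounded_of_geometricStep`).  NO numerical gain for Bałaban's step (same number); the gain is that the
  hypothesis now matches the weakest sockets of the spine (U6's `Summable δ`, U5b's uniform bracket) with nothing geometric in between;
* SHARPNESS of `< 1` (§5): the diagonal channel `a k j = 𝟙_{j=k}` (Schur norms `= 1`) with `lam ≡ 1` has `minMod k i = 1` for all `i < k` —
  unbounded columns AND rows (`minMod_diagChannel`, `not_colBounded_diagChannel`); this is the arithmetic of `sticky_not_fadingMemory`.
For the classification of NE9 this is NEUTRAL: the wall is the one-step model W1 (the functional and its `StepLipschitz` constants for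
Bałaban's E^{(j)}), unchanged; N2 is re-expressed, not discharged.

WHAT IS PROVED (kernel; elementary real analysis, `[folklore]`): §1 `minTable_succ_of_ne`, `minTable_succ_self`, `minTable_stable`, `minMod_zero`,
`minMod_birth`, `minMod_of_lt`, `minMod_of_le`, `minMod_succ_eq`, `renewalSuper_minMod`, `minMod_nonneg`, `ne9_minMod`; §2 `colSum_minMod_succ_le`,
`colSum_minMod_le`, `rowSum_minMod_succ_le`, `rowSum_minMod_le`; §3 `ne9_colBounded_of_schurStep`, `ne9_rowBounded_of_schurStep`,
`ne9_l1Bracket_of_schurStep`; §4 `schurNorms_of_geometricChannel`, `schur_lt_one_iff`, `ne9_colBounded_of_geometricStep`; §5 `minMod_diagChannel`,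
`not_colBounded_diagChannel`.

HONEST FRAMING: bookkeeping for rung (B)+1 on a FIXED finite four-torus; facts about the SHAPE of the NE9 recursion, not about Bałaban's
functionals (no `StepLipschitz` constant of Bałaban's E^{(j)} is printed or asserted); NE9 is NOT PRINTED ([Balaban1987RG1] p. 263 gives only
*"It is a C^∞-function of g_{j−1} ∈ [0, γ], (or analytic)"*, p. 256 ∕ p. 298 the existence of the dependence on all preceding couplings) and
NOT PROVED; spine PROVED 0∕9 unchanged; NOT UV stability, NOT the continuum limit, NOT infinite volume, NOT a mass gap, NOT Clay.  HONEST
DEPENDENCY: continuum YM on T⁴ ⇐ BetaPertH ∧ nine spine estimates (0∕9 proved); BetaPertH ⇐ (D1) ∧ (D4) ∧ CAP+tail.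

References (TYPES only): [Balaban1987RG1] = T. Bałaban, Commun. Math. Phys. **109** (1987) 249–301, (0.23) p. 256, (2.12)–(2.13) p. 268,
p. 263, p. 298.
-/

namespace Summit.QuantumFields.BalabanUV.T4Continuum.NE9.SchurRenewal

open scoped BigOperators
open Finset Filter Topology
open Literature.MathematicalPhysics.QuantumFieldTheory.Balaban1983to89
open Literature.MathematicalPhysics.QuantumFieldTheory.Balaban1983to89.T4OutputRate
open Literature.MathematicalPhysics.QuantumFieldTheory.Balaban1983to89.T4HistoryLipschitzRecursion
  (ScaleZeroFree StepLipschitz RenewalSuper ne9_of_stepLipschitz)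
open Summit.QuantumFields.BalabanUV.T4Continuum.NE9.SchurMemory
  (colSum_le_of_fadingMemory rowSum_le_of_fadingMemory ne9_bracket_of_colSum)

/-! ## §1 The minimal solution of the renewal equalities -/

/-- The minimal-solution TABLE, built row by row: `minTable lam a n k i` is the entry `(k, i)` of the minimal solution of the renewal
equalities if the row `k` has been built (`k ≤ n`), and `0` otherwise.  Row `n + 1` is computed from the rows `≤ n`: the diagonal-adjacent
entry `(n+1, n)` is the last-coupling constant `lam n`; an older entry `(n+1, i)`, `i < n`, inherits `Σ_{j ∈ (i, n]} a n j·Λ j i` through the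
terms created at the steps `j = i+1, …, n`; entries with `i > n` vanish. [folklore] -/
noncomputable def minTable (lam : ℕ → ℝ) (a : ℕ → ℕ → ℝ) : ℕ → ℕ → ℕ → ℝ
  | 0 => fun _ _ => 0
  | n + 1 => fun k i =>
      if k = n + 1 then
        (if i = n then lam n
          else if i < n then ∑ j ∈ Ico (i + 1) (n + 1), a n j * minTable lam a n j i else 0)
      else minTable lam a n k i

/-- THE MINIMAL HISTORY MODULI of the step data `(lam, a)`: `minMod lam a k i` = entry `(k, i)` of the table once row `k` is built.
[folklore] -/
noncomputable def minMod (lam : ℕ → ℝ) (a : ℕ → ℕ → ℝ) (k i : ℕ) : ℝ :=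
  minTable lam a k k i

variable {lam : ℕ → ℝ} {a : ℕ → ℕ → ℝ}

/-- Rows already built are not touched when a new row is added. [folklore] -/
theorem minTable_succ_of_ne {n k : ℕ} (hk : k ≠ n + 1) (i : ℕ) :
    minTable lam a (n + 1) k i = minTable lam a n k i := by
  simp only [minTable, if_neg hk]

/-- The new row, as defined. [folklore] -/
theorem minTable_succ_self (n i : ℕ) :
    minTable lam a (n + 1) (n + 1) i =
      if i = n then lam n else if i < n then ∑ j ∈ Ico (i + 1) (n + 1), a n j * minTable lam a n j i else 0 := by
  simp only [minTable, ite_true]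

/-- STABILITY: every table containing row `k` holds the same row `k`. [folklore] -/
theorem minTable_stable {n k : ℕ} (hk : k ≤ n) (i : ℕ) : minTable lam a n k i = minMod lam a k i := by
  induction n with
  | zero =>
    obtain rfl := Nat.le_zero.mp hk
    rfl
  | succ n ih =>
    rcases hk.lt_or_eq with h | h
    · rw [minTable_succ_of_ne (Nat.ne_of_lt h)]
      exact ih (Nat.lt_succ_iff.mp h)
    · subst h
      rfl

/-- No term is created at step `0`: row `0` vanishes. [folklore] -/
theorem minMod_zero (i : ℕ) : minMod lam a 0 i = 0 := rfl

/-- RENEWAL EQUALITY AT BIRTH: the term created at step `k + 1` feels the last coupling `g_k` with modulus `lam k`. [folklore] -/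
theorem minMod_birth (k : ℕ) : minMod lam a (k + 1) k = lam k := by
  show minTable lam a (k + 1) (k + 1) k = lam k
  rw [minTable_succ_self, if_pos rfl]

/-- RENEWAL EQUALITY FOR AN OLDER COUPLING: `minMod (k+1) i = Σ_{j ∈ (i, k]} a k j·minMod j i` for `i < k`. [folklore] -/
theorem minMod_of_lt {k i : ℕ} (hik : i < k) :
    minMod lam a (k + 1) i = ∑ j ∈ Ico (i + 1) (k + 1), a k j * minMod lam a j i := by
  show minTable lam a (k + 1) (k + 1) i = _
  rw [minTable_succ_self, if_neg (Nat.ne_of_lt hik), if_pos hik]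
  refine sum_congr rfl fun j hj => ?_
  rw [minTable_stable (Nat.lt_succ_iff.mp (mem_Ico.mp hj).2)]

/-- No influence of couplings at or after the creation step: `minMod k i = 0` for `k ≤ i`. [folklore] -/
theorem minMod_of_le {k i : ℕ} (hki : k ≤ i) : minMod lam a k i = 0 := by
  cases k with
  | zero => rfl
  | succ n =>
    show minTable lam a (n + 1) (n + 1) i = 0
    rw [minTable_succ_self, if_neg (by omega), if_neg (by omega)]

/-- The two renewal equalities in one line: for `i ≤ k`,
`minMod (k+1) i = 𝟙_{i=k}·lam k + Σ_{j ∈ (i, k]} a k j·minMod j i` (the sum is empty at `i = k`). [folklore] -/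
theorem minMod_succ_eq {k i : ℕ} (hik : i ≤ k) :
    minMod lam a (k + 1) i = (if i = k then lam k else 0) + ∑ j ∈ Ico (i + 1) (k + 1), a k j * minMod lam a j i := by
  rcases hik.lt_or_eq with h | h
  · rw [minMod_of_lt h, if_neg (Nat.ne_of_lt h), zero_add]
  · subst h
    rw [minMod_birth, if_pos rfl, Ico_self, sum_empty, add_zero]

/-- **THE MINIMAL MODULI SOLVE THE RENEWAL INEQUALITIES** of `T4HistoryLipschitzRecursion` (with equality). [folklore] -/
theorem renewalSuper_minMod (lam : ℕ → ℝ) (a : ℕ → ℕ → ℝ) : RenewalSuper lam a (minMod lam a) :=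
  ⟨fun k => (minMod_birth k).ge, fun _ _ hik => (minMod_of_lt hik).ge⟩

/-- Nonnegative step data give nonnegative minimal moduli. [folklore] -/
theorem minMod_nonneg (hlam : ∀ k, 0 ≤ lam k) (ha : ∀ k j, j ≤ k → 0 ≤ a k j) (k i : ℕ) :
    0 ≤ minMod lam a k i := by
  induction k using Nat.strong_induction_on generalizing i with
  | h k ih =>
    cases k with
    | zero => rw [minMod_zero]
    | succ n =>
      rcases lt_trichotomy i n with h | h | h
      · rw [minMod_of_lt h]
        exact sum_nonneg fun j hj =>
          mul_nonneg (ha n j (Nat.lt_succ_iff.mp (mem_Ico.mp hj).2)) (ih j (mem_Ico.mp hj).2 i)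
      · subst h
        rw [minMod_birth]
        exact hlam _
      · rw [minMod_of_le (by omega)]

/-- **NE9 WITH THE MINIMAL MODULI**: no term at step `0` + the one-step Lipschitz inequality ⇒ `NE9 E W κ (minMod lam a)`, for an arbitrary
window (`T4HistoryLipschitzRecursion.ne9_of_stepLipschitz` BY NAME on the super-solution `renewalSuper_minMod`). [folklore] -/
theorem ne9_minMod {C : Carriers} {Bg : Type} {E : Functional C Bg} {W : Set (ℕ → ℝ)} {κ : ℝ}
    (h0 : ScaleZeroFree E W) (hS : StepLipschitz E W κ lam a) : NE9 E W κ (minMod lam a) :=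
  ne9_of_stepLipschitz h0 hS (renewalSuper_minMod lam a)

/-! ## §2 The two Schur bounds -/

/-- **THE COLUMN RENEWAL STEP**: with `0 ≤ lam ≤ ℓ`, `a ≥ 0` and channel COLUMN sums `Σ_{k ∈ [j, N)} a k j ≤ α`, the column partial sums
`S_N = Σ_{k ∈ (i, N)} minMod k i` of the minimal moduli obey `S_{N+1} ≤ ℓ + α·S_N` (reindex `k = k'+1`, apply the renewal equalities,
swap the finite double sum). [folklore] -/
theorem colSum_minMod_succ_le {ℓ α : ℝ} (hlam : ∀ k, 0 ≤ lam k ∧ lam k ≤ ℓ) (ha : ∀ k j, j ≤ k → 0 ≤ a k j)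
    (hcolA : ∀ j N, ∑ k ∈ Ico j N, a k j ≤ α) (i N : ℕ) :
    ∑ k ∈ Ico (i + 1) (N + 1), minMod lam a k i ≤ ℓ + α * ∑ k ∈ Ico (i + 1) N, minMod lam a k i := by
  have hm0 : ∀ k, 0 ≤ minMod lam a k i := fun k => minMod_nonneg (fun k => (hlam k).1) ha k i
  have hre : ∑ k ∈ Ico (i + 1) (N + 1), minMod lam a k i = ∑ k ∈ Ico i N, minMod lam a (k + 1) i :=
    (sum_Ico_add' (fun k => minMod lam a k i) i N 1).symm
  have hsplit : ∑ k ∈ Ico i N, minMod lam a (k + 1) i =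
      ∑ k ∈ Ico i N, (if i = k then lam k else 0)
        + ∑ k ∈ Ico i N, ∑ j ∈ Ico (i + 1) (k + 1), a k j * minMod lam a j i := by
    rw [← sum_add_distrib]
    exact sum_congr rfl fun k hk => minMod_succ_eq (mem_Ico.mp hk).1
  have hA : ∑ k ∈ Ico i N, (if i = k then lam k else 0) ≤ ℓ := by
    rw [sum_ite_eq]
    split_ifs
    · exact (hlam i).2
    · exact (hlam 0).1.trans (hlam 0).2
  have hB : ∑ k ∈ Ico i N, ∑ j ∈ Ico (i + 1) (k + 1), a k j * minMod lam a j i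
      ≤ α * ∑ j ∈ Ico (i + 1) N, minMod lam a j i := by
    have hswap : ∑ k ∈ Ico i N, ∑ j ∈ Ico (i + 1) (k + 1), a k j * minMod lam a j i =
        ∑ j ∈ Ico (i + 1) N, ∑ k ∈ Ico j N, a k j * minMod lam a j i := by
      refine sum_comm' fun k j => ?_
      simp only [mem_Ico]
      omega
    rw [hswap, mul_sum]
    refine sum_le_sum fun j _ => ?_
    rw [← sum_mul]
    exact mul_le_mul_of_nonneg_right (hcolA j N) (hm0 j)
  rw [hre, hsplit]
  linarith

/-- **COLUMN SCHUR BOUND**: `0 ≤ lam ≤ ℓ`, `a ≥ 0`, channel column sums `≤ α < 1` ⇒ every column of the minimal moduli is `≤ ℓ∕(1−α)`: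
`Σ_{k ∈ (i, N)} minMod k i ≤ ℓ∕(1−α)` for all `i`, `N` — the total influence of one coupling on all later terms is bounded, with NO rate.
[folklore] -/
theorem colSum_minMod_le {ℓ α : ℝ} (hlam : ∀ k, 0 ≤ lam k ∧ lam k ≤ ℓ) (ha : ∀ k j, j ≤ k → 0 ≤ a k j)
    (hcolA : ∀ j N, ∑ k ∈ Ico j N, a k j ≤ α) (hα : α < 1) (i N : ℕ) :
    ∑ k ∈ Ico (i + 1) N, minMod lam a k i ≤ ℓ / (1 - α) := by
  have hα0 : 0 ≤ α := by simpa using hcolA 0 0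
  have hℓ : 0 ≤ ℓ := (hlam 0).1.trans (hlam 0).2
  have h1α : 0 < 1 - α := by linarith
  induction N with
  | zero =>
    rw [Ico_eq_empty_of_le (Nat.zero_le _), sum_empty]
    positivity
  | succ N ih =>
    calc ∑ k ∈ Ico (i + 1) (N + 1), minMod lam a k i ≤ ℓ + α * ∑ k ∈ Ico (i + 1) N, minMod lam a k i :=
          colSum_minMod_succ_le hlam ha hcolA i N
      _ ≤ ℓ + α * (ℓ / (1 - α)) := by gcongr
      _ = ℓ / (1 - α) := by
          field_simp
          ring

/-- **THE ROW RENEWAL STEP**: with `0 ≤ lam ≤ ℓ`, `a ≥ 0`, channel ROW sums `Σ_{j ≤ k} a k j ≤ α′`, and all rows `j ≤ k` of the minimal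
moduli `≤ B` (`B ≥ 0`), row `k + 1` is `≤ ℓ + α′·B`. [folklore] -/
theorem rowSum_minMod_succ_le {ℓ α' B : ℝ} (hlam : ∀ k, 0 ≤ lam k ∧ lam k ≤ ℓ) (ha : ∀ k j, j ≤ k → 0 ≤ a k j)
    (hrowA : ∀ k, ∑ j ∈ range (k + 1), a k j ≤ α') (k : ℕ)
    (hB : ∀ j ≤ k, ∑ i ∈ range (j + 1), minMod lam a j i ≤ B) (hB0 : 0 ≤ B) :
    ∑ i ∈ range (k + 1 + 1), minMod lam a (k + 1) i ≤ ℓ + α' * B := by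
  have hm0 : ∀ j i, 0 ≤ minMod lam a j i := fun j i => minMod_nonneg (fun k => (hlam k).1) ha j i
  rw [sum_range_succ, minMod_of_le le_rfl, add_zero]
  have hsplit : ∑ i ∈ range (k + 1), minMod lam a (k + 1) i =
      ∑ i ∈ range (k + 1), (if i = k then lam k else 0)
        + ∑ i ∈ range (k + 1), ∑ j ∈ Ico (i + 1) (k + 1), a k j * minMod lam a j i := by
    rw [← sum_add_distrib]
    exact sum_congr rfl fun i hi => minMod_succ_eq (Nat.lt_succ_iff.mp (mem_range.mp hi))
  have hA : ∑ i ∈ range (k + 1), (if i = k then lam k else 0) = lam k := by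
    rw [sum_ite_eq']
    simp
  have hswap : ∑ i ∈ range (k + 1), ∑ j ∈ Ico (i + 1) (k + 1), a k j * minMod lam a j i =
      ∑ j ∈ range (k + 1), ∑ i ∈ range j, a k j * minMod lam a j i := by
    refine sum_comm' fun i j => ?_
    simp only [mem_range, mem_Ico]
    omega
  have hB' : ∑ j ∈ range (k + 1), ∑ i ∈ range j, a k j * minMod lam a j i ≤ α' * B := by
    calc ∑ j ∈ range (k + 1), ∑ i ∈ range j, a k j * minMod lam a j i
        = ∑ j ∈ range (k + 1), a k j * ∑ i ∈ range j, minMod lam a j i :=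
          sum_congr rfl fun j _ => by rw [mul_sum]
      _ ≤ ∑ j ∈ range (k + 1), a k j * B := by
          refine sum_le_sum fun j hj => mul_le_mul_of_nonneg_left ?_ (ha k j (Nat.lt_succ_iff.mp (mem_range.mp hj)))
          have hsub : ∑ i ∈ range j, minMod lam a j i ≤ ∑ i ∈ range (j + 1), minMod lam a j i :=
            sum_le_sum_of_subset_of_nonneg (range_mono (Nat.le_succ j)) fun i _ _ => hm0 j i
          exact hsub.trans (hB j (Nat.lt_succ_iff.mp (mem_range.mp hj)))
      _ = (∑ j ∈ range (k + 1), a k j) * B := by rw [sum_mul]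
      _ ≤ α' * B := mul_le_mul_of_nonneg_right (hrowA k) hB0
  rw [hsplit, hA, hswap]
  linarith [(hlam k).2]

/-- **ROW SCHUR BOUND**: `0 ≤ lam ≤ ℓ`, `a ≥ 0`, channel row sums `≤ α′ < 1` ⇒ every row of the minimal moduli is `≤ ℓ∕(1−α′)`:
`Σ_{i ≤ k} minMod k i ≤ ℓ∕(1−α′)` for all `k` (the hypothesis shape `hrow` of the β-side station (E33) and of `SchurMemory` §2). [folklore] -/
theorem rowSum_minMod_le {ℓ α' : ℝ} (hlam : ∀ k, 0 ≤ lam k ∧ lam k ≤ ℓ) (ha : ∀ k j, j ≤ k → 0 ≤ a k j)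
    (hrowA : ∀ k, ∑ j ∈ range (k + 1), a k j ≤ α') (hα' : α' < 1) (k : ℕ) :
    ∑ i ∈ range (k + 1), minMod lam a k i ≤ ℓ / (1 - α') := by
  have hα0 : 0 ≤ α' := le_trans (sum_nonneg fun j hj => ha 0 j (Nat.lt_succ_iff.mp (mem_range.mp hj))) (hrowA 0)
  have hℓ : 0 ≤ ℓ := (hlam 0).1.trans (hlam 0).2
  have h1α : 0 < 1 - α' := by linarith
  induction k using Nat.strong_induction_on with
  | h k ih =>
    cases k with
    | zero =>
      rw [sum_range_one, minMod_zero]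
      positivity
    | succ n =>
      calc ∑ i ∈ range (n + 1 + 1), minMod lam a (n + 1) i ≤ ℓ + α' * (ℓ / (1 - α')) :=
            rowSum_minMod_succ_le hlam ha hrowA n (fun j hj => ih j (Nat.lt_succ_of_le hj)) (by positivity)
        _ = ℓ / (1 - α') := by
            field_simp
            ring

/-! ## §3 End to end: Schur-contractive channel ⇒ Schur-bounded NE9 moduli ⇒ the sockets of nodes U5b ∕ U6 -/

/-- **RATE-FREE RENEWAL, COLUMN FORM.**  No term at step `0`, the one-step Lipschitz inequality `StepLipschitz E W κ lam a` with
`0 ≤ lam ≤ ℓ`, `a ≥ 0`, and a COLUMN-SCHUR-CONTRACTIVE old-term channel (`Σ_{k ≥ j} a k j ≤ α < 1`: one created term re-enters all later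
terms with total weight `< 1`) ⇒ `NE9 E W κ Λ` with nonnegative moduli whose COLUMN sums are `≤ ℓ∕(1−α)`.  No geometric rate is assumed
or produced. [folklore] -/
theorem ne9_colBounded_of_schurStep {C : Carriers} {Bg : Type} {E : Functional C Bg} {W : Set (ℕ → ℝ)} {κ ℓ α : ℝ}
    (h0 : ScaleZeroFree E W) (hS : StepLipschitz E W κ lam a)
    (hlam : ∀ k, 0 ≤ lam k ∧ lam k ≤ ℓ) (ha : ∀ k j, j ≤ k → 0 ≤ a k j)
    (hcolA : ∀ j N, ∑ k ∈ Ico j N, a k j ≤ α) (hα : α < 1) :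
    NE9 E W κ (minMod lam a) ∧ (∀ k i, i ≤ k → 0 ≤ minMod lam a k i) ∧
      ∀ i N, ∑ k ∈ Ico (i + 1) N, minMod lam a k i ≤ ℓ / (1 - α) :=
  ⟨ne9_minMod h0 hS, fun k i _ => minMod_nonneg (fun k => (hlam k).1) ha k i, colSum_minMod_le hlam ha hcolA hα⟩

/-- **RATE-FREE RENEWAL, ROW FORM.**  The same with a ROW-SCHUR-CONTRACTIVE channel (`Σ_{j ≤ k} a k j ≤ α′ < 1`: the new term's total
sensitivity to all old terms is `< 1`) ⇒ `NE9 E W κ Λ` with nonnegative moduli whose ROW sums are `≤ ℓ∕(1−α′)` — the shape consumed by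
`SchurMemory.ne9_uniform_of_rowSum` (node U5b) and by the β-side row split of (E33). [folklore] -/
theorem ne9_rowBounded_of_schurStep {C : Carriers} {Bg : Type} {E : Functional C Bg} {W : Set (ℕ → ℝ)} {κ ℓ α' : ℝ}
    (h0 : ScaleZeroFree E W) (hS : StepLipschitz E W κ lam a)
    (hlam : ∀ k, 0 ≤ lam k ∧ lam k ≤ ℓ) (ha : ∀ k j, j ≤ k → 0 ≤ a k j)
    (hrowA : ∀ k, ∑ j ∈ range (k + 1), a k j ≤ α') (hα' : α' < 1) :
    NE9 E W κ (minMod lam a) ∧ (∀ k i, i ≤ k → 0 ≤ minMod lam a k i) ∧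
      ∀ k, ∑ i ∈ range (k + 1), minMod lam a k i ≤ ℓ / (1 - α') :=
  ⟨ne9_minMod h0 hS, fun k i _ => minMod_nonneg (fun k => (hlam k).1) ha k i, rowSum_minMod_le hlam ha hrowA hα'⟩

/-- **… TO NODE U6 WITHOUT ANY RATE.**  Under the column form, two admissible coupling histories with ℓ¹ discrepancies `|g^A_i − g^B_i| ≤ d_i`,
`Σ d_i < ∞`, have scale-`j` term differences `≤ e^{−κd_j(X)}·b_j`, `b_j = Σ_{i<j} minMod j i·d_i`, with `Σ_j b_j ≤ ℓ(1−α)⁻¹·Σ_i d_i` — an ℓ¹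
bracket, node U6's input (`SchurMemory.ne9_bracket_of_colSum` BY NAME); no `FadingMemory`, no `θ^j`, no `InjectedRate`. [folklore] -/
theorem ne9_l1Bracket_of_schurStep {C : Carriers} {Bg : Type} {E : Functional C Bg} {W : Set (ℕ → ℝ)} {κ ℓ α : ℝ}
    (h0 : ScaleZeroFree E W) (hS : StepLipschitz E W κ lam a)
    (hlam : ∀ k, 0 ≤ lam k ∧ lam k ≤ ℓ) (ha : ∀ k j, j ≤ k → 0 ≤ a k j)
    (hcolA : ∀ j N, ∑ k ∈ Ico j N, a k j ≤ α) (hα : α < 1)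
    {gA gB : ℕ → ℝ} (hgA : gA ∈ W) (hgB : gB ∈ W) {d : ℕ → ℝ} (hd : ∀ i, |gA i - gB i| ≤ d i) (hdsum : Summable d) :
    (∀ (U : Bg) (X : C.Dom), |E gA U X - E gB U X|
        ≤ Real.exp (-(κ * C.d X)) * ∑ i ∈ range (C.scale X), minMod lam a (C.scale X) i * d i)
      ∧ Summable (fun j => ∑ i ∈ range j, minMod lam a j i * d i)
      ∧ ∑' j, ∑ i ∈ range j, minMod lam a j i * d i ≤ ℓ / (1 - α) * ∑' i, d i := by
  obtain ⟨h9, hnn, hcol⟩ := ne9_colBounded_of_schurStep h0 hS hlam ha hcolA hα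
  exact ne9_bracket_of_colSum h9 hnn hcol hgA hgB hd hdsum

/-! ## §4 Consistency with the record: N2 is the Schur contractivity of the geometric channel -/

/-- **BAŁABAN'S CHANNEL IS GEOMETRIC, HENCE SCHUR-BOUNDED BY `c(1−ω)⁻¹` IN BOTH NORMS.**  The record's channel hypothesis
`0 ≤ a k j ≤ c·ω^{k−j}` (`j ≤ k`, `0 ≤ ω < 1`) is literally `T4OutputRate.FadingMemory c ω a` read on the channel, so `SchurMemory` §1 applies:
column sums `Σ_{k ∈ [j, N)} a k j ≤ c(1−ω)⁻¹` and row sums `Σ_{j ≤ k} a k j ≤ c(1−ω)⁻¹`. [folklore] -/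
theorem schurNorms_of_geometricChannel {c ω : ℝ} (hω0 : 0 ≤ ω) (hω1 : ω < 1)
    (ha : ∀ k j, j ≤ k → 0 ≤ a k j ∧ a k j ≤ c * ω ^ (k - j)) :
    (∀ j N, ∑ k ∈ Ico j N, a k j ≤ c * (1 - ω)⁻¹) ∧ (∀ k, ∑ j ∈ range (k + 1), a k j ≤ c * (1 - ω)⁻¹) :=
  ⟨fun j N => colSum_le_of_fadingMemory (Λ := a) ha hω0 hω1 j N, fun k => rowSum_le_of_fadingMemory (Λ := a) ha hω0 hω1 k⟩

/-- **N2 ⟺ SCHUR CONTRACTIVITY** for the geometric channel: `c(1−ω)⁻¹ < 1 ⟺ ω + c < 1` (`ω < 1`) — the smallness clause `hsmall` of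
`T4HistoryLipschitzRecursion.ne9_and_fadingMemory_of_geometricStep`, i.e. the record's N2 `c < 1 − ω`, is exactly «the geometric channel's
Schur norm is `< 1`». [folklore] -/
theorem schur_lt_one_iff {c ω : ℝ} (hω1 : ω < 1) : c * (1 - ω)⁻¹ < 1 ↔ ω + c < 1 := by
  have h : 0 < 1 - ω := by linarith
  rw [← div_eq_mul_inv, div_lt_one h]
  constructor <;> intro h' <;> linarith

/-- **THE RECORD'S GEOMETRIC STEP, RE-READ RATE-FREE.**  `ScaleZeroFree` + `StepLipschitz E W κ lam a` with `0 ≤ lam ≤ ℓ` and the geometric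
channel `0 ≤ a k j ≤ c·ω^{k−j}`, under N2 `ω + c < 1` ⇒ NE9 with nonnegative moduli of column sums AND row sums `≤ ℓ∕(1 − c(1−ω)⁻¹)` —
the sockets of nodes U6 (via `SchurMemory` §3) and U5b (§2) served with no `FadingMemory` statement in between.  (The record's own route
gives the sharper geometric moduli `ℓ(ω+c)^{k−1−i}`; this is the currency-matched reading, same clause N2.) [folklore] -/
theorem ne9_colBounded_of_geometricStep {C : Carriers} {Bg : Type} {E : Functional C Bg} {W : Set (ℕ → ℝ)} {κ ℓ c ω : ℝ}
    (h0 : ScaleZeroFree E W) (hS : StepLipschitz E W κ lam a)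
    (hlam : ∀ k, 0 ≤ lam k ∧ lam k ≤ ℓ) (hω0 : 0 ≤ ω) (hω1 : ω < 1)
    (ha : ∀ k j, j ≤ k → 0 ≤ a k j ∧ a k j ≤ c * ω ^ (k - j)) (hsmall : ω + c < 1) :
    NE9 E W κ (minMod lam a) ∧ (∀ k i, i ≤ k → 0 ≤ minMod lam a k i) ∧
      (∀ i N, ∑ k ∈ Ico (i + 1) N, minMod lam a k i ≤ ℓ / (1 - c * (1 - ω)⁻¹)) ∧
      (∀ k, ∑ i ∈ range (k + 1), minMod lam a k i ≤ ℓ / (1 - c * (1 - ω)⁻¹)) := by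
  obtain ⟨hcolA, hrowA⟩ := schurNorms_of_geometricChannel hω0 hω1 ha
  have hα : c * (1 - ω)⁻¹ < 1 := (schur_lt_one_iff hω1).mpr hsmall
  have ha0 : ∀ k j, j ≤ k → 0 ≤ a k j := fun k j h => (ha k j h).1
  exact ⟨ne9_minMod h0 hS, fun k i _ => minMod_nonneg (fun k => (hlam k).1) ha0 k i,
    colSum_minMod_le hlam ha0 hcolA hα, rowSum_minMod_le hlam ha0 hrowA hα⟩

/-! ## §5 Sharpness of `< 1`: the diagonal channel (Schur norms `= 1`) has unbounded columns and rows -/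

/-- THE DIAGONAL CHANNEL `a k j = 𝟙_{j=k}` with `lam ≡ 1` (each term re-enters exactly the next one, with weight one — both Schur norms
`= 1`): the minimal moduli are `minMod k i = 1` for ALL `i < k` (the newest coupling is never forgotten; the arithmetic of
`T4HistoryLipschitzRecursion.sticky_not_fadingMemory`). [folklore] -/
theorem minMod_diagChannel {k i : ℕ} (hik : i < k) :
    minMod (fun _ => (1 : ℝ)) (fun k j => if j = k then (1 : ℝ) else 0) k i = 1 := by
  induction k with
  | zero => exact absurd hik (Nat.not_lt_zero i)
  | succ n ih =>
    rcases (Nat.lt_succ_iff.mp hik).lt_or_eq with h | h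
    · rw [minMod_of_lt h, Finset.sum_Ico_succ_top (by omega : i + 1 ≤ n), if_pos (rfl : n = n), one_mul, ih h]
      rw [sum_eq_zero fun j hj => by rw [if_neg (Nat.ne_of_lt (mem_Ico.mp hj).2), zero_mul], zero_add]
    · subst h
      exact minMod_birth i

/-- … hence its column `i` below the cutoff `N` is `N − 1 − i`: NOT bounded — at Schur norm `= 1` the column bound of §2 fails, as it must
(and so does the row bound: row `k` sums to `k`). [folklore] -/
theorem not_colBounded_diagChannel (i : ℕ) (Mc : ℝ) :
    ∃ N, Mc < ∑ k ∈ Ico (i + 1) N, minMod (fun _ => (1 : ℝ)) (fun k j => if j = k then (1 : ℝ) else 0) k i := by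
  refine ⟨i + 1 + (⌈Mc⌉₊ + 1), ?_⟩
  rw [sum_congr rfl fun k hk => minMod_diagChannel (mem_Ico.mp hk).1, sum_const, Nat.card_Ico, nsmul_eq_mul, mul_one]
  rw [show i + 1 + (⌈Mc⌉₊ + 1) - (i + 1) = ⌈Mc⌉₊ + 1 by omega]
  push_cast
  linarith [Nat.le_ceil Mc]

end Summit.QuantumFields.BalabanUV.T4Continuum.NE9.SchurRenewal
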